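import Mathlib
import HarnessLib
import Summits.QuantumFields.YangMills.Theses.BalabanUVNodes
import Literature.MathematicalPhysics.QuantumFieldTheory.Balaban1983to89.B16Thm1BaseAtRecord11

/-!
# `BalabanUVNodes.StabilityBAtRecordR11e` (K1, stmt-QuantumFields-19674) — NEGATIVE LEMMA modulo K0 `Record11Inhabited` (stmt-QuantumFields-19673):
# at NODE 00's Stage-11 record AS PINNED, K1 is false at every inhabited family; K2 `EndpointGivenBR11` (19675) is VACUOUS AS TYPED

Seat `pub-ymgap-dag-n13-e` (R134 acceleration seat N13 [B16], strategy s3; cell `pub-ymgap`, HUMAN RULING D-0062).  Count-neutral ROUTE-LEVEL PACKAGING of the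
located negative of `Literature.MathematicalPhysics.QuantumFieldTheory.Balaban1983to89.B16Thm1BaseAtRecord11` (same seat): at every Stage-11 record `(D, w)`
(`Node00.IsRecordOfRecord₁₁C F 2 D w`) whose runs enter every small coupling window, the pin (B) `B16.EndStatementBPrinted D.C` FAILS
(`not_endStatementBPrinted_of_isRecordOfRecord₁₁C_of_window`), because [Balaban1989LargeFieldII] Thm 1's induction BASE «ρ₀ = exp[−(1∕g₀²)A − E]»
([Balaban1988Convergent] Thm 1 p. 262) is UNSATISFIABLE AS PINNED: the level-0 background map of record reads no configuration (a length-0 sequence has an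
empty determining set), so the level-0 §2-form slot is constant while `ρ₀` is not (N = 2, g₀ > 0 in the window).

**Route consequences (rev 6∕7 of `route-QuantumFields-BalabanUVNodes`, items K0–K3 = 19673–19676 over `Node00.IsRecordOfRecord₁₁C F 2`).**
* `not_endStatementB_window_of_isRecordOfRecord₁₁C` — for every family, datum and world: a Stage-11 record NEVER carries «(B) ∧ window» (the consequent of K1).
* **`StabilityBAtRecordR11e_false_of_Record11Inhabited : Record11Inhabited → ¬ StabilityBAtRecordR11e`** — K0 ∧ K1 are JOINTLY UNSATISFIABLE as typed: given
  inhabitation at the family `F13` (`L = 13`, `m = 1`), K1 would produce a record with (B) ∧ window.  (`--negative-modulo Record11Inhabited`: K0 is an OPEN item —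
  no Stage-11 record is constructed in the tree —, so this is a NEGATIVE LEMMA, not a refutation of K1; the planner's repair duty is the RESTATE at the repaired
  Stage-12 pin, never a re-wording in place.)
* `not_exists_record₁₁C_of_StabilityBAtRecordR11e` — contrapositive reading: K1 as typed says «NO family carries a Stage-11 record».
* **`EndpointGivenBR11_of_vacuity : EndpointGivenBR11`** — K2's hypotheses «record, (B), window» are CONTRADICTORY, so K2 holds EX FALSO.  THIS IS A VACUITY
  CERTIFICATE, NOT A DISCHARGE: filed `--supports`, never `--workitem`; under the cell's protocol («no ex falso», dag-ref-D REFD-G20-VACUITY-AMENDMENT) the chair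
  does not book K2 on it.  It is landed so that the defect is kernel-visible to the tribunal and the planner (class MISSTATED-PIN; repair below).

**The repair (for the planner ∕ NODE 00 definers; proved print-side in `B16Thm1BaseAtRecord11` §6 `hasSect2FormAE_zero_printedBackground`).**  Pin the level-0
background map of record to the print's reading `U₀ := 𝐖 ↦ 𝐖 0` ([III] Thm 1 p. 262: at `k = 0` the background is the field itself), leaving every `k ≥ 1`
unchanged (def-T's successor record `Record12`); then the base is a THEOREM with no hypothesis and [V] Thm 1 at the record is `B16.thm1_of_steps` of the 𝐓-step law
(N11) and the 𝐑-leaf (N13) alone (`B16Thm1BaseAtRecord11` §5).  The repaired K1′ reads as K1 with `IsRecordOfRecord₁₂C`; the witness of this file (the constant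
level-0 slot) does not exist there.

HONEST FRAMING.  Kernel bookkeeping about the tree's OWN Stage-11 pin; nothing of Bałaban's is asserted or refuted; no estimate; no node discharged; counts UNMOVED
(typed 28∕28 · discharged 5∕28).  One finite four-torus programme at fixed `ε`, Bałaban AS PRINTED; NOT ℝ⁴, NOT OS axioms, NOT a mass gap, NOT Clay.  0 `def`,
0 `sorry`, standard axioms.
-/

noncomputable section

namespace Summit.QuantumFields.YangMills.Theorems.BalabanUVNodesStabilityBAtRecordR11e.Negative

open Literature.MathematicalPhysics.QuantumFieldTheory.Balaban1983to89
open Literature.MathematicalPhysics.QuantumFieldTheory.Balaban1983to89.T4Continuum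
open Summit.QuantumFields.YangMills.Theses.BalabanUVNodes

/-- **A STAGE-11 RECORD NEVER CARRIES «(B) ∧ WINDOW» (the consequent of K1), group of record `SU(2)`**: `B16Thm1BaseAtRecord11.false_of_isRecordOfRecord₁₁C_endStatementB_window`
at `N = 2`. [cite: Balaban1989LargeFieldII, Thm 1 p.355 + p.391 (as pinned at the tree's Stage-11 record; located negative)] -/
theorem not_endStatementB_window_of_isRecordOfRecord₁₁C (F : T4Family) (D : FiniteEpsData F (Matrix.specialUnitaryGroup (Fin 2) ℂ)) (w : DagBinding.WorldP)
    (hrec : Node00.IsRecordOfRecord₁₁C F 2 D w) :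
    ¬ (B16.EndStatementBPrinted D.C ∧ ∃ γ₁ : ℝ, 0 < γ₁ ∧ ∀ γ : ℝ, 0 < γ → γ ≤ γ₁ →
        ∃ P : B12.RunParams, 1 ≤ P.K ∧ (D.C P).flow.InInterval γ P.K) :=
  fun h => B16Thm1BaseAtRecord11.false_of_isRecordOfRecord₁₁C_endStatementB_window F 2 le_rfl hrec h.1 h.2

/-- **K1 AS TYPED SAYS THAT NO FAMILY CARRIES A STAGE-11 RECORD**: at an inhabited family its consequent «record ∧ (B) ∧ window» is unsatisfiable
(`not_endStatementB_window_of_isRecordOfRecord₁₁C`). [cite: Balaban1989LargeFieldII, Thm 1 p.355 + p.391 (as pinned; located negative)] -/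
theorem not_exists_record₁₁C_of_StabilityBAtRecordR11e (h1 : StabilityBAtRecordR11e) (F : T4Family) :
    ¬ ∃ (D : FiniteEpsData F (Matrix.specialUnitaryGroup (Fin 2) ℂ)) (w : DagBinding.WorldP), Node00.IsRecordOfRecord₁₁C F 2 D w := by
  intro hF
  obtain ⟨D, w, hrec, hB, hwin⟩ := h1 F hF
  exact not_endStatementB_window_of_isRecordOfRecord₁₁C F D w hrec ⟨hB, hwin⟩

/-- **NEGATIVE LEMMA FOR K1 MODULO K0**: `Record11Inhabited → ¬ StabilityBAtRecordR11e` — K0 provides a Stage-11 record at the family `F13 = (L = 13, m = 1)`, and K1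
as typed forbids any (`not_exists_record₁₁C_of_StabilityBAtRecordR11e`): K0 ∧ K1 are JOINTLY UNSATISFIABLE.  `H = Record11Inhabited` is the route's OPEN item
stmt-QuantumFields-19673 (no Stage-11 record is constructed in the tree), so K1 is HELD, not refuted; the planner's repair is the restate at the Stage-12 pin.
[cite: Balaban1989LargeFieldII, Thm 1 p.355 + p.391 (as pinned; located negative modulo inhabitation)] -/
theorem StabilityBAtRecordR11e_false_of_Record11Inhabited : Record11Inhabited → ¬ StabilityBAtRecordR11e := by
  intro h0 h1
  let F13 : T4Family := ⟨13, ⟨⟨6, rfl⟩, by norm_num⟩, by norm_num, 1, le_rfl⟩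
  exact not_exists_record₁₁C_of_StabilityBAtRecordR11e h1 F13 (h0 F13)

/-- **VACUITY CERTIFICATE FOR K2 (stmt-QuantumFields-19675) — NOT A DISCHARGE**: `EndpointGivenBR11`'s three hypotheses «Stage-11 record, (B), window» are jointly
unsatisfiable (`not_endStatementB_window_of_isRecordOfRecord₁₁C`), so K2 holds EX FALSO as typed.  Filed `--supports` only; under the cell's «no ex falso» rule the
chair does not book K2 on this term, and the planner restates K2 at the repaired Stage-12 pin (where this proof does not type-check). [cite: Balaban1987RG1, Thm 2 p.259 (the endpoint statement K2 re-expresses; here only the vacuity of its Stage-11 hypotheses is certified)] -/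
theorem EndpointGivenBR11_of_vacuity : EndpointGivenBR11 :=
  fun F D w hrec hB hwin => (not_endStatementB_window_of_isRecordOfRecord₁₁C F D w hrec ⟨hB, hwin⟩).elim

end Summit.QuantumFields.YangMills.Theorems.BalabanUVNodesStabilityBAtRecordR11e.Negative

end
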